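import Summits.QuantumFields.BalabanUV.T4Continuum.Support.NE9SizeFedCoupling
import Summits.QuantumFields.BalabanUV.T4Continuum.Support.NE9Lemma1SpeciesEnd
import Summits.QuantumFields.BalabanUV.T4Continuum.Support.NE9KernelSpeciesCoupling

/-!
# NE9SizeFedCouplingSpecies — the LAST displayed channel binder of the ASSEMBLED-SPECIES END, leaf A3's coupling modulus
# `hTcup` of `NE9Lemma1SpeciesEnd.termSize_ne9_and_fadingMemory_species_compProj` (owner g25, p215007), PRODUCED in the tree,
# SIZE-FED, for a GENERAL projection `P` of the old terms (read-out twin in the sibling `…ReadOut`): species (a)'s A3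
# `channelCouplingModulus_cur` (p214647) + species (b)'s A3 `channelCouplingModulus_ker` (A3-KER, p214870) at the PROJECTED
# family `fun g => P (Ef g)`, assembled by (w25)-M's `tcup_add` (p214472) on (w25)'s common output weight (p214415)
# (cell `pub-balaban`, T4-DAG §2 node U3 ∕ §6 NE9; NE9 formalisation swarm, unit `b2b-balaban-t4-ne9-formalise-leaf-05` gen 6;
# own-lineage follow-through «A3-FED-SPECIES» of «A3-FED» p215358, CLAIMS.log (this module's CLAIM line); at own risk)

HONEST FRAMING (T4-DAG PAGE 1).  Rung (B)+1 of the FINITE-VOLUME T⁴ programme — existence AND uniqueness of the ε → 0 limit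
of gauge-invariant observables on a fixed torus; NOT infinite volume, NOT a mass gap, NOT the Clay problem.  NE9
(`T4OutputRate.NE9` ∧ `FadingMemory`) is a cell NEW ESTIMATE, NOT PRINTED, and is NOT discharged here («NE9 ⇐ the named
binders»); spine 0∕9; 0∕18 skeleton leaves instantiated on Bałaban's objects (O-NE9-1).  HONEST DEPENDENCY (cell line,
verbatim): continuum YM on T⁴ ⇐ BetaPertH ∧ nine spine estimates (0/9 proved); BetaPertH ⇐ (D1) ∧ (D4) ∧ CAP+tail; G-an2-4
gates asym, D1 and NE2/3/4.  [I] = [Balaban1987RG1] (CMP **109**), [II] = [Balaban1988RG2Cluster] (CMP **116**) are quoted for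
TYPES only (ABSOLUTE RULE: nothing printed in the audited series is asserted).  No `def`, no Prop-valued definition;
`FlowStep.BetaPertH`, (B), (B^μ) do not occur.

WHERE THIS SITS.  The owner's assembled-species END (p215007) discharged every CHANNEL binder of the skeleton's END-M face at
𝒯 = cpieceChannel D.toC + cpieceChannel K.toC except ONE: leaf A3's coupling modulus `hTcup` (the SAME old terms at two
values of the LAST coupling, [II] (2.14)–(2.15) p. 15), displayed at the common output weight `weightOf D.toC.frame κ₁ d₀ O1
(Kp_(a) + Kp_(b))`.  Both species HAVE A3 producers — `NE9CurveSpeciesCoupling.channelCouplingModulus_cur` (this lineage, (w20))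
and `NE9KernelSpeciesCoupling.channelCouplingModulus_ker` (leaf-09, A3-KER) — but each reads the family it is fed through its
analyticity and its inductive size (1.18) `TermSize`, while the face feeds the channel the PROJECTED family `P (Ef g)` and
OUTPUTS `TermSize Ef`.  leaf-09-g6's cross-read probe of p215007 (C-ne9leaf09g6-3, (P1)) produced `hTcup` at `P := id` and
recorded, with leaf-04-g6 (C-ne9leaf04g6-3 INFO 1), what a general `P` wants: the projected family's analyticity and
`TermSize`.  THIS FILE supplies both and plugs the producers in, size-fed (A3-FED's order: size FIRST, then A3):
* §1 **`termSize_proj`** — the PROJECTED family's size: `TermSize E W κ N`, `AdmRestrict`, `ProjScaleComm Adm P`,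
  `ProjSize Adm P κ c` ⟹ `TermSize (fun g => P (E g)) W κ ((1 + c)·N)` (generic; [I] (1.18) currency with the face's own
  projection-cost letter `c`).  Analyticity of `P (Ef g)` needs NO new binder: the face's `ProjInto Adm MF P` + `MF ⊆ analyticClass`.
* §2 **`tcup_species_proj`** — the SIZE-FED producer `TermSize Ef W κ N →` (`hTcup` of p215007 at a general `P`) with the
  k-uniform constant `(64·clip·cQ_(a) + λ·cQ_(b))·((1 + c)·N̄)·(1 − ω)⁻¹`: the two A3 leaves at `fun g => P (Ef g)` + `tcup_add`
  + `weightOf_mono` ∕ `weightOf_frame_congr` under the face's identification binders `hκ₁` ∕ `hR` ∕ `hdY`.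
* §3 **`termSize_ne9_and_fadingMemory_species_compProj_fedA3`** — THE OWNER's FACE p215007 WITH `hTcup` PRODUCED: binders
  p215007's with `hTcup`, `hqT0` (and the profile `qT`) GONE, `hqTb` ↦ ONE scalar inequality `(…) ≤ qTbar` (`qTbar` stays
  SYMBOLIC, c6), ADDED = the producers' own displayed binders — curves: `0 ≤ clip`, `0 < c_dir`, `0 < ℓ`, `hhalf`, (c1) `hcont`,
  (c2) `hlip`, (c3) `hroom` (A3-CUR's, verbatim); kernels: `0 ≤ λ`, (C) `hkerC`, (K-Lip) `hkerL` (A3-KER's, verbatim);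
  `N j ≤ N̄`; `ω < 1`.  Proof: the owner's `hsum` ∕ `hstep` ∕ `hadd` ∕ `hτ` assembly BY NAME, then A3-FED §2
  (`termSize_ne9_and_fadingMemory_compProj_fed`: size first) fed with §2.  Conclusion LITERALLY p215007's.
* the READ-OUT twin (`P := margProj r A`, END-M `…_margProj`'s RO ∕ AW binders) is the sibling module
  `NE9SizeFedCouplingSpeciesReadOut` (`termSize_ne9_and_fadingMemory_species_margProj_fedA3`; the ≤ 400-line rule splits it off).
After §3 (and its read-out twin) the END's displayed list for the FULL species channel of [I] §§3–4 has NO channel-level binder left: O1-type data,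
`CurData.Admissible` ∕ `KerData.Admissible`, the two level counts, the two `PieceAdditiveOn` ((w19) ∕ (w23)), `MF ⊆ analyticClass`,
the projection ∕ read-out binders, A1∕A2 (`hCup`), R1 ∕ KP ∕ box binders, and the two A3 producers' (c1)–(c3) ∕ (C) ∕ (K-Lip)
TYPE binders.  NOT PRINTED and not claimed: that Bałaban's U_j(□₀, exp iσ′B)-curves and (4.21)∕(4.25)∕(4.29)∕(4.30)-kernels meet
these binders (O-NE9-1 ∕ O-NE9-5).  DISGUISE TEST: one input family, two values of the LAST coupling, size first — leaf A3
bookkeeping, not NE9.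

WHAT IS PROVED (kernel, `[folklore]` bookkeeping; 0 sorry, 0 `def`): §1 `termSize_proj`; §2 `tcup_species_proj`;
§3 `termSize_ne9_and_fadingMemory_species_compProj_fedA3`.

References (TYPES only): [Balaban1987RG1] T. Bałaban, CMP **109** (1987) 249–301, (0.28)–(0.30) p. 258, (1.3) p. 260, (1.18)
p. 263, (1.20)–(1.22) p. 264, (3.34) p. 277, (3.53)–(3.54) p. 280, (4.22) p. 286; [Balaban1988RG2Cluster] T. Bałaban, CMP **116**
(1988) 1–22, (1.21)–(1.29) pp. 7–8, (1.33)–(1.36) p. 9, (2.14)–(2.15) p. 15, Lemma 3 (2.38) p. 20.  Summits-side NEW work (LEAN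
PLACEMENT RULE); imports A3-FED `NE9SizeFedCoupling` (p215358), the owner's `NE9Lemma1SpeciesEnd` (p215007) and A3-KER
`NE9KernelSpeciesCoupling` (p214870) BY NAME (hence END-M, (w25) `NE9ChannelSum`, (w25)-M `NE9ChannelSumMargProj`, A3-CUR
`NE9CurveSpeciesCoupling`, the two species modules); modifies nothing; no END face re-wired (new faces beside the old).
Value = the assembled-species END's last channel binder produced, NOT summit progress.
-/

noncomputable section

namespace Summit.QuantumFields.BalabanUV.T4Continuum.NE9SizeFedCouplingSpecies

open scoped BigOperators
open Metric Set
open Literature.Probability.LatticeModels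
open Literature.MathematicalPhysics.QuantumFieldTheory.Balaban1983to89
open Literature.MathematicalPhysics.QuantumFieldTheory.Balaban1983to89.T4OutputRate
open Literature.MathematicalPhysics.QuantumFieldTheory.Balaban1983to89.T4HistoryLipschitzRecursion
open Literature.MathematicalPhysics.QuantumFieldTheory.Balaban1983to89.T4HistoryLipschitzOuter
open Literature.MathematicalPhysics.QuantumFieldTheory.Balaban1983to89.T4HistoryLipschitzActivity
open Literature.MathematicalPhysics.QuantumFieldTheory.Balaban1983to89.T4HistoryLipschitzActivity (ClusterGeom)
open Literature.MathematicalPhysics.QuantumFieldTheory.Balaban1983to89.T4HistoryLipschitzSegment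
open Summit.QuantumFields.BalabanUV.T4Continuum.NE9Lemma1Counting
open Summit.QuantumFields.BalabanUV.T4Continuum.NE9Lemma1Gain
open Summit.QuantumFields.BalabanUV.T4Continuum.NE9Lemma1PieceClass
open Summit.QuantumFields.BalabanUV.T4Continuum.NE9Lemma1RemainderSpecies
open Summit.QuantumFields.BalabanUV.T4Continuum.NE9Lemma1CurveSpecies
open Summit.QuantumFields.BalabanUV.T4Continuum.NE9Lemma1KernelSpecies
open Summit.QuantumFields.BalabanUV.T4Continuum.NE9Lemma1RemainderSpeciesEnd (channelSizeAtStepNN_mono pieceAdditiveOn_mono)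
open Summit.QuantumFields.BalabanUV.T4Continuum.NE9Lemma1SpeciesEnd (profile_species)
open Summit.QuantumFields.BalabanUV.T4Continuum.NE9ComplexEncoding (doubleCarriers)
open Summit.QuantumFields.BalabanUV.T4Continuum.NE9MarginalProjection
open Summit.QuantumFields.BalabanUV.T4Continuum.NE9MarginalProjectionEnd
open Summit.QuantumFields.BalabanUV.T4Continuum.NE9ChannelSum
open Summit.QuantumFields.BalabanUV.T4Continuum.NE9ChannelSumMargProj (compProj_add tcup_add)
open Summit.QuantumFields.BalabanUV.T4Continuum.NE9CurveSpeciesCoupling (channelCouplingModulus_cur)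
open Summit.QuantumFields.BalabanUV.T4Continuum.NE9KernelSpeciesCoupling (channelCouplingModulus_ker)
open Summit.QuantumFields.BalabanUV.T4Continuum.NE9SizeFedCoupling

/-! ## §1 The PROJECTED family's inductive size (1.18) -/

section Generic

variable {C : Carriers} {Bg : Type}

/-- **THE PROJECTED FAMILY'S SIZE (kernel).**  If the window's terms obey `TermSize E W κ N`, the admissible class is closed
under one-step restriction (`AdmRestrict`), and the projection acts step by step (`ProjScaleComm`) at cost `1 + c` in the
`e^{−κd}·N` currency (`ProjSize`), then the PROJECTED family `g ↦ P (E g)` obeys `TermSize … W κ ((1 + c)·N)`.  On a domain X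
of creation step j, `P (E g)` is the projection of the step-j slice `restrictScale j (E g)` read on X.  This is the
«MP-AN-side» size the species' A3 producers want at a general projection (C-ne9leaf04g6-3 INFO 1, C-ne9leaf09g6-3 (P1)).
[cite: Balaban1987RG1, (1.3) p.260, (1.18) p.263] -/
theorem termSize_proj {E : Functional C Bg} {W : Set (ℕ → ℝ)} {Adm : Set (Bg → C.Dom → ℝ)}
    {P : (Bg → C.Dom → ℝ) → (Bg → C.Dom → ℝ)} {κ c : ℝ} {N : ℕ → ℝ}
    (hres : AdmRestrict Adm) (hPcomm : ProjScaleComm Adm P) (hPsize : ProjSize Adm P κ c)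
    (hAdmE : ∀ g ∈ W, E g ∈ Adm) (hNnn : ∀ j, 0 ≤ N j) (hT : TermSize E W κ N) :
    TermSize (fun g => P (E g)) W κ (fun j => (1 + c) * N j) := by
  intro g hg U X
  have hH : E g ∈ Adm := hAdmE g hg
  -- on X the projected family is the projection of the creation-step slice of `E g`
  have h1 : P (E g) U X = P (restrictScale (C.scale X) (E g)) U X := by
    rw [hPcomm (E g) hH (C.scale X)]
    exact (restrictScale_of_eq (P (E g)) rfl).symm
  show |P (E g) U X| ≤ Real.exp (-(κ * C.d X)) * ((1 + c) * N (C.scale X))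
  rw [h1]
  exact hPsize (C.scale X) (restrictScale (C.scale X) (E g)) (hres.1 (E g) hH (C.scale X))
    (fun U' X' hX' => restrictScale_of_ne (E g) hX') (N (C.scale X)) (hNnn _)
    (fun U' X' hX' => by
      rw [restrictScale_of_eq (E g) hX']
      have h := hT g hg U' X'
      rw [hX'] at h
      exact h) U X rfl

end Generic

/-! ## §2 The SIZE-FED coupling modulus of the assembled species channel at a general projection -/

section Species

variable {C₀ : Carriers} {E : Type} [NormedAddCommGroup E] [NormedSpace ℂ E]
  {ι α β γ δ α' β' γ' δ' Pt : Type} [DecidableEq δ] [DecidableEq δ']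

/-- **LEAF A3 FOR THE ASSEMBLED SPECIES CHANNEL AT A GENERAL PROJECTION, SIZE-FED (kernel).**  From `TermSize Ef W κ N` (fed by
the END, which proves it first): the coupling modulus `hTcup` of p215007 — channel `cpieceChannel D.toC + cpieceChannel K.toC`
fed with the PROJECTED old terms `P (Ef g)`, common output weight `weightOf D.toC.frame D.κ₁ d₀ O1 (D.Kp c_dir + K.Kp cK w₀ c₀ c₁)`,
k-uniform constant `(64·clip·cQ_(a) + λ·cQ_(b))·((1 + c)·N̄)·(1 − ω)⁻¹`.  Chain: §1 (size of the projected family, `N̄′ = (1+c)·N̄`);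
species (a)'s `channelCouplingModulus_cur` and species (b)'s `channelCouplingModulus_ker` at `Ef := fun g => P (Ef g)` (their
analyticity binder from `hPE`, the kernel's class via `hR`); (w25)'s `weightOf_mono` ∕ `weightOf_frame_congr` (via `hκ₁`, `hdY`,
`Kp ≥ 0`); (w25)-M's `compProj_add` + `tcup_add`.  Displayed (TYPE, asserted nowhere about Bałaban's objects): the two data's
`Admissible`, (c1)–(c3) for the curves, (C)∕(K-Lip) for the kernels, the two level counts, `hPE`.
[cite: Balaban1988RG2Cluster, (1.21)-(1.29) pp.7-8, (1.36) p.9, (2.14)-(2.15) p.15; Balaban1987RG1, (1.18) p.263, (3.53)-(3.54) p.280, (4.22) p.286] -/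
theorem tcup_species_proj {D : CurData C₀ E ι α β γ δ} {K : KerData C₀ E ι α' β' γ' δ' Pt}
    {ℓg ℓk gain : ℕ → ℕ → ℝ} {cdir cK δ₀ δ₁ w w0 c0 c1 d0 O1 cQa cQb κ ω Nbar clip lam c : ℝ} {N : ℕ → ℝ}
    {Ef : Functional (doubleCarriers C₀) E} {W : Set (ℕ → ℝ)} {Adm : Set (E → (doubleCarriers C₀).Dom → ℝ)}
    {P : (E → (doubleCarriers C₀).Dom → ℝ) → (E → (doubleCarriers C₀).Dom → ℝ)}
    -- the projection: step-wise, of cost 1 + c; the window's terms admissible; the projected family analytic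
    (hres : AdmRestrict Adm) (hPcomm : ProjScaleComm Adm P) (hPsize : ProjSize Adm P κ c) (hc : 0 ≤ c)
    (hAdmE : ∀ g ∈ W, Ef g ∈ Adm) (hPE : ∀ g ∈ W, P (Ef g) ∈ analyticClass D.R)
    (hN0 : ∀ j, 0 ≤ N j) (hNb : ∀ j, N j ≤ Nbar)
    -- species (a): A3-CUR's binders
    (hD : D.Admissible ℓg cdir d0) (hclip : 0 ≤ clip) (hcdir : 0 < cdir) (hℓ : ∀ k j, 0 < ℓg k j)
    (hhalf : ∀ k j, cdir * ℓg k j < 1 / 2)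
    (hcont : ∀ (k : ℕ) (s : ℕ → ℝ) (y : ι) (a : α) (b : β) (x : (doubleCarriers C₀).Dom),
      ContinuousOn (fun q : (ℂ × ((δ → ℝ) × (δ → ℂ))) × ℂ => D.cur k s y a b x q.1.1 q.1.2.1 q.1.2.2 q.2)
        ((sphere (0:ℂ) (D.r k) ×ˢ {q | OnContour D.κ₁ (D.cubes k y a b) q.1 q.2}) ×ˢ sphere (0:ℂ) 1))
    (hlip : ∀ g ∈ W, ∀ g' ∈ W, ∀ (k : ℕ) (y : ι), ∀ a ∈ D.S0 k y, ∀ b ∈ D.SY k y a, ∀ (j : ℕ), ∀ x ∈ D.src k y a j,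
      ∀ t ∈ sphere (0:ℂ) (D.r k), ∀ (s' : δ → ℝ) (σ' : δ → ℂ), OnContour D.κ₁ (D.cubes k y a b) s' σ' →
        ∀ τ ∈ ball (0:ℂ) (1 / (2 * (cdir * ℓg k j))),
          ‖D.cur k g y a b x t s' σ' τ - D.cur k g' y a b x t s' σ' τ‖ ≤ clip * (D.R x.1 / 2) * |g k - g' k|)
    (hroom : ∀ g ∈ W, ∀ (k : ℕ) (y : ι), ∀ a ∈ D.S0 k y, ∀ b ∈ D.SY k y a, ∀ (j : ℕ), ∀ x ∈ D.src k y a j,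
      ∀ t ∈ sphere (0:ℂ) (D.r k), ∀ (s' : δ → ℝ) (σ' : δ → ℂ), OnContour D.κ₁ (D.cubes k y a b) s' σ' →
        ∀ τ ∈ ball (0:ℂ) (1 / (2 * (cdir * ℓg k j))), ‖D.cur k g y a b x t s' σ' τ‖ ≤ D.R x.1 / 2)
    (hLa : LevelCountsG D.toC.frame κ D.κ₁ O1 cQa (fun k j => ℓg k j ^ 5) (agePow ω))
    -- species (b): A3-KER's binders, on the SAME κ₁ ∕ radii ∕ output geometry (p215007's identification binders)
    (hK : K.Admissible ℓk gain cK δ₀ δ₁ w w0 c0 c1 d0) (hκ₁ : K.κ₁ = D.κ₁) (hR : K.R = D.R)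
    (hdY : K.toC.frame.dY = D.toC.frame.dY) (hlam : 0 ≤ lam)
    (hkerC : ∀ (k : ℕ) (s : ℕ → ℝ) (y : ι) (a : α') (b : β') (x : (doubleCarriers C₀).Dom), ∀ p ∈ K.pts k y a,
      ∀ q ∈ K.pts k y a, ∀ F : E → ℂ, DifferentiableOn ℂ F (ball 0 (K.R x.1)) →
        Continuous fun wv : ℂ × (δ' → ℝ) × (δ' → ℂ) => K.ker k s y a b x wv.1 wv.2.1 wv.2.2 p q F)
    (hkerL : ∀ g ∈ W, ∀ g' ∈ W, ∀ (k : ℕ) (y : ι), ∀ a ∈ K.S0 k y, ∀ b ∈ K.SY k y a, ∀ (j : ℕ), ∀ x ∈ K.src k y a j,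
      ∀ t ∈ sphere (0:ℂ) (K.r k), ∀ (s' : δ' → ℝ) (σ' : δ' → ℂ), OnContour K.κ₁ (K.cubes k y a b) s' σ' →
        ∀ p ∈ K.pts k y a, ∀ q ∈ K.pts k y a, ∀ (F : E → ℂ) (M : ℝ),
          DifferentiableOn ℂ F (ball 0 (K.R x.1)) → (∀ z ∈ ball (0:E) (K.R x.1), ‖F z‖ ≤ M) →
            ‖K.ker k g y a b x t s' σ' p q F - K.ker k g' y a b x t s' σ' p q F‖ ≤
              cK * lam * M * gain k j * K.ρd p q ^ K.m * Real.exp (-(δ₀ * (K.dX x.1 p + K.dX x.1 q))) * |g k - g' k|)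
    (hLb : LevelCountsG K.toC.frame (κ - w) K.κ₁ O1 cQb gain (agePow ω))
    (hO1 : 0 ≤ O1) (hcQa : 0 ≤ cQa) (hcQb : 0 ≤ cQb) (hω0 : 0 ≤ ω) (hω1 : ω < 1) :
    TermSize Ef W κ N → ∀ g ∈ W, ∀ g' ∈ W, ∀ (k : ℕ) (y : ι),
      |compProj (cpieceChannel D.toC + cpieceChannel K.toC) P k g (Ef g) y -
          compProj (cpieceChannel D.toC + cpieceChannel K.toC) P k g' (Ef g) y| ≤
        weightOf D.toC.frame D.κ₁ d0 O1 (D.Kp cdir + K.Kp cK w0 c0 c1) k y *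
          ((64 * clip * cQa + lam * cQb) * ((1 + c) * Nbar) * (1 - ω)⁻¹ * |g k - g' k|) := by
  intro hT g hg g' hg' k y
  -- size of the PROJECTED family (§1), with the profile (1+c)·N ≤ (1+c)·N̄
  have hTP : TermSize (fun g => P (Ef g)) W κ (fun j => (1 + c) * N j) := termSize_proj hres hPcomm hPsize hAdmE hN0 hT
  have hc1 : 0 ≤ 1 + c := by linarith
  have hN0' : ∀ j, 0 ≤ (fun j => (1 + c) * N j) j := fun j => mul_nonneg hc1 (hN0 j)
  have hNb' : ∀ j, (fun j => (1 + c) * N j) j ≤ (1 + c) * Nbar := fun j => mul_le_mul_of_nonneg_left (hNb j) hc1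
  -- species (a) and (b): the two A3 leaves at the projected family
  have ha := channelCouplingModulus_cur hD (Ef := fun g => P (Ef g)) hPE hTP hN0' hNb' hclip hcdir hℓ hhalf hcont hlip hroom
    hLa hO1 hcQa hω0 hω1
  have hPE' : ∀ g ∈ W, P (Ef g) ∈ analyticClass K.R := by rw [hR]; exact hPE
  have hb := channelCouplingModulus_ker hK (Ef := fun g => P (Ef g)) hPE' hTP hN0' hNb' hlam hkerC hkerL hLb hO1 hcQb hω0 hω1
  rw [hκ₁] at hb
  -- weight dominations at the common output frame ((w25)'s letters)
  have hwa : ∀ k y, weightOf D.toC.frame D.κ₁ d0 O1 (D.Kp cdir) k y ≤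
      weightOf D.toC.frame D.κ₁ d0 O1 (D.Kp cdir + K.Kp cK w0 c0 c1) k y :=
    fun k y => weightOf_mono D.toC.frame hO1 (fun k y => le_add_of_nonneg_right (kp_nonneg_ker hK k y)) k y
  have hwb : ∀ k y, weightOf K.toC.frame D.κ₁ d0 O1 (K.Kp cK w0 c0 c1) k y ≤
      weightOf D.toC.frame D.κ₁ d0 O1 (D.Kp cdir + K.Kp cK w0 c0 c1) k y := by
    intro k y
    rw [weightOf_frame_congr D.toC.frame K.toC.frame hdY]
    exact weightOf_mono D.toC.frame hO1 (fun k y => le_add_of_nonneg_left (kp_nonneg hD k y)) k y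
  have hNbar : 0 ≤ Nbar := (hN0 0).trans (hNb 0)
  have h1ω : 0 < 1 - ω := by linarith
  have hqa : ∀ _k : ℕ, (0:ℝ) ≤ 64 * clip * ((1 + c) * Nbar) * cQa * (1 - ω)⁻¹ := fun _ => by positivity
  have hqb : ∀ _k : ℕ, (0:ℝ) ≤ lam * ((1 + c) * Nbar) * cQb * (1 - ω)⁻¹ := fun _ => by positivity
  have h := tcup_add (E := Ef) (Ta := compProj (cpieceChannel D.toC) P) (Tb := compProj (cpieceChannel K.toC) P)
    (qTa := fun _ => 64 * clip * ((1 + c) * Nbar) * cQa * (1 - ω)⁻¹)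
    (qTb := fun _ => lam * ((1 + c) * Nbar) * cQb * (1 - ω)⁻¹) ha hb hwa hwb hqa hqb g hg g' hg' k y
  rw [compProj_add]
  calc |(compProj (cpieceChannel D.toC) P + compProj (cpieceChannel K.toC) P) k g (Ef g) y -
          (compProj (cpieceChannel D.toC) P + compProj (cpieceChannel K.toC) P) k g' (Ef g) y|
      ≤ weightOf D.toC.frame D.κ₁ d0 O1 (D.Kp cdir + K.Kp cK w0 c0 c1) k y *
          (((fun _ => 64 * clip * ((1 + c) * Nbar) * cQa * (1 - ω)⁻¹ : ℕ → ℝ) +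
              (fun _ => lam * ((1 + c) * Nbar) * cQb * (1 - ω)⁻¹ : ℕ → ℝ)) k * |g k - g' k|) := h
    _ = weightOf D.toC.frame D.κ₁ d0 O1 (D.Kp cdir + K.Kp cK w0 c0 c1) k y *
          ((64 * clip * cQa + lam * cQb) * ((1 + c) * Nbar) * (1 - ω)⁻¹ * |g k - g' k|) := by
        simp only [Pi.add_apply]; ring

/-! ## §3 The OWNER's assembled-species END (`…_compProj` face, p215007) with leaf A3 PRODUCED -/

/-- **THE NE9 END (`…_compProj` face) AT THE ASSEMBLED SPECIES CHANNEL 𝒯 = 𝒯_(a) + 𝒯_(b) WITH ITS COUPLING MODULUS PRODUCED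
(kernel).**  p215007's `termSize_ne9_and_fadingMemory_species_compProj` with the channel binder `hTcup` (and `hqT0`, the profile
`qT`) GONE — produced size-fed by §2 — and `hqTb` replaced by the scalar `(64·clip·cQ_(a) + λ·cQ_(b))·((1 + c)·N̄)·(1 − ω)⁻¹ ≤ qTbar`
(`qTbar` symbolic); ADDED: the A3 producers' displayed binders (curves: `0 ≤ clip`, `0 < c_dir`, `0 < ℓ`, `hhalf`, (c1)–(c3);
kernels: `0 ≤ λ`, (C), (K-Lip)), `N j ≤ N̄`, `ω < 1`.  S-SUM ∕ S5 ∕ S3 ∕ profile of the sum assembled BY NAME exactly as in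
p215007; size FIRST (A3-FED `termSize_ne9_and_fadingMemory_compProj_fed`).  Conclusion LITERALLY p215007's (τ̄ = cQ_(a) + cQ_(b)).
[cite: Balaban1987RG1, (0.28)-(0.30) p.258, (1.3) p.260, (1.18) p.263, (3.34) p.277, (3.53)-(3.54) p.280, (4.22) p.286; Balaban1988RG2Cluster, (1.23)-(1.29) pp.7-8, (1.33)-(1.36) p.9, (2.14)-(2.15) p.15, Lemma 3 (2.38) p.20] -/
theorem termSize_ne9_and_fadingMemory_species_compProj_fedA3 (G : ClusterGeom (doubleCarriers C₀)) {Pot : Type*}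
    [NormedAddCommGroup Pot] [NormedSpace ℂ Pot] {D : CurData C₀ E ι α β γ δ} {K : KerData C₀ E ι α' β' γ' δ' Pt}
    {ℓg ℓk gain : ℕ → ℕ → ℝ} {cdir cK δ₀ δ₁ w w0 c0 c1 d0 O1 cQa cQb : ℝ}
    {Ef : Functional (doubleCarriers C₀) E} {W : Set (ℕ → ℝ)}
    {Adm MF : Set (E → (doubleCarriers C₀).Dom → ℝ)}
    {P : (E → (doubleCarriers C₀).Dom → ℝ) → (E → (doubleCarriers C₀).Dom → ℝ)}
    {Ψ : ℕ → ℝ → (ι → ℝ) → E → (doubleCarriers C₀).Dom → ℝ} {act : ℕ → ℝ → E → Pot → G.P → ℂ} {𝒜 : ℕ → Set Pot}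
    {n : ℕ → ℝ → E → G.P → ℝ} {lip clip : ℕ → ℝ} {a d : G.P → ℝ} {δv : (doubleCarriers C₀).Dom → ℝ}
    {κ B lipbar clipbar qTbar ω c Nbar clipa lam : ℝ} {p₀ N : ℕ → ℝ}
    -- species (a): the curve datum and its binders (S5 ∕ S3 as in p215007; A3-CUR's (c1)–(c3) and scalars)
    (hD : D.Admissible ℓg cdir d0) (hℓ : ∀ k j, 0 < ℓg k j)
    (hLa : LevelCountsG D.toC.frame κ D.κ₁ O1 cQa (fun k j => ℓg k j ^ 5) (agePow ω))
    (hAa : PieceAdditiveOn (analyticClass D.R) D.toC)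
    (hclipa : 0 ≤ clipa) (hcdir : 0 < cdir) (hhalf : ∀ k j, cdir * ℓg k j < 1 / 2)
    (hcont : ∀ (k : ℕ) (s : ℕ → ℝ) (y : ι) (a : α) (b : β) (x : (doubleCarriers C₀).Dom),
      ContinuousOn (fun q : (ℂ × ((δ → ℝ) × (δ → ℂ))) × ℂ => D.cur k s y a b x q.1.1 q.1.2.1 q.1.2.2 q.2)
        ((sphere (0:ℂ) (D.r k) ×ˢ {q | OnContour D.κ₁ (D.cubes k y a b) q.1 q.2}) ×ˢ sphere (0:ℂ) 1))
    (hlip : ∀ g ∈ W, ∀ g' ∈ W, ∀ (k : ℕ) (y : ι), ∀ a ∈ D.S0 k y, ∀ b ∈ D.SY k y a, ∀ (j : ℕ), ∀ x ∈ D.src k y a j,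
      ∀ t ∈ sphere (0:ℂ) (D.r k), ∀ (s' : δ → ℝ) (σ' : δ → ℂ), OnContour D.κ₁ (D.cubes k y a b) s' σ' →
        ∀ τ ∈ ball (0:ℂ) (1 / (2 * (cdir * ℓg k j))),
          ‖D.cur k g y a b x t s' σ' τ - D.cur k g' y a b x t s' σ' τ‖ ≤ clipa * (D.R x.1 / 2) * |g k - g' k|)
    (hroom : ∀ g ∈ W, ∀ (k : ℕ) (y : ι), ∀ a ∈ D.S0 k y, ∀ b ∈ D.SY k y a, ∀ (j : ℕ), ∀ x ∈ D.src k y a j,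
      ∀ t ∈ sphere (0:ℂ) (D.r k), ∀ (s' : δ → ℝ) (σ' : δ → ℂ), OnContour D.κ₁ (D.cubes k y a b) s' σ' →
        ∀ τ ∈ ball (0:ℂ) (1 / (2 * (cdir * ℓg k j))), ‖D.cur k g y a b x t s' σ' τ‖ ≤ D.R x.1 / 2)
    -- species (b): the kernel datum and its binders, on the SAME κ₁ ∕ radii ∕ output geometry (A3-KER's (C), (K-Lip), λ)
    (hK : K.Admissible ℓk gain cK δ₀ δ₁ w w0 c0 c1 d0) (hκ₁ : K.κ₁ = D.κ₁) (hR : K.R = D.R)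
    (hdY : K.toC.frame.dY = D.toC.frame.dY)
    (hLb : LevelCountsG K.toC.frame (κ - w) K.κ₁ O1 cQb gain (agePow ω))
    (hAb : PieceAdditiveOn (analyticClass K.R) K.toC) (hlam : 0 ≤ lam)
    (hkerC : ∀ (k : ℕ) (s : ℕ → ℝ) (y : ι) (a : α') (b : β') (x : (doubleCarriers C₀).Dom), ∀ p ∈ K.pts k y a,
      ∀ q ∈ K.pts k y a, ∀ F : E → ℂ, DifferentiableOn ℂ F (ball 0 (K.R x.1)) →
        Continuous fun wv : ℂ × (δ' → ℝ) × (δ' → ℂ) => K.ker k s y a b x wv.1 wv.2.1 wv.2.2 p q F)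
    (hkerL : ∀ g ∈ W, ∀ g' ∈ W, ∀ (k : ℕ) (y : ι), ∀ a ∈ K.S0 k y, ∀ b ∈ K.SY k y a, ∀ (j : ℕ), ∀ x ∈ K.src k y a j,
      ∀ t ∈ sphere (0:ℂ) (K.r k), ∀ (s' : δ' → ℝ) (σ' : δ' → ℂ), OnContour K.κ₁ (K.cubes k y a b) s' σ' →
        ∀ p ∈ K.pts k y a, ∀ q ∈ K.pts k y a, ∀ (F : E → ℂ) (M : ℝ),
          DifferentiableOn ℂ F (ball 0 (K.R x.1)) → (∀ z ∈ ball (0:E) (K.R x.1), ‖F z‖ ≤ M) →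
            ‖K.ker k g y a b x t s' σ' p q F - K.ker k g' y a b x t s' σ' p q F‖ ≤
              cK * lam * M * gain k j * K.ρd p q ^ K.m * Real.exp (-(δ₀ * (K.dX x.1 p + K.dX x.1 q))) * |g k - g' k|)
    (hO1 : 0 ≤ O1) (hcQa : 0 ≤ cQa) (hcQb : 0 ≤ cQb) (hMF : MF ⊆ analyticClass D.R)
    -- the face's binders, verbatim (p215007), at 𝒯 := cpieceChannel D.toC + cpieceChannel K.toC — minus `hTcup` ∕ `hqT0`
    (ρ : ℕ → (ι → ℝ) → Pot) (U₀ : E) (explZ : ℕ → E → (doubleCarriers C₀).Dom → ℝ) (h0 : ScaleZeroFree Ef W)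
    (hAdm : AdmissibleTerms Ef W Adm) (hres : AdmRestrict Adm)
    (hPadd : ProjAdditive Adm P) (hPcomm : ProjScaleComm Adm P) (hPinto : ProjInto Adm MF P) (hPsize : ProjSize Adm P κ c)
    (hc : 0 ≤ c)
    (hfac : Factorises Ef W (compProj (cpieceChannel D.toC + cpieceChannel K.toC) P) Ψ) (hclip0 : ∀ k, 0 ≤ clip k)
    (hCup : ∀ g ∈ W, ∀ g' ∈ W, ∀ (k : ℕ) (U : E) (X : (doubleCarriers C₀).Dom), (doubleCarriers C₀).scale X = k + 1 →
      ∀ Q ∈ 𝒜 k, ∀ γ' ∈ G.vol X,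
      ‖act k (g k) U Q γ'‖ ≤ n k (g' k) U γ' ∧
        ‖act k (g k) U Q γ' - act k (g' k) U Q γ'‖ ≤ clip k * |g k - g' k| * n k (g' k) U γ')
    (hreprV : ∀ (k : ℕ) (s : ℝ) (Q : ι → ℝ) (U : E) (X : (doubleCarriers C₀).Dom),
      Ψ k s Q U X = (G.newTerm act k s U X (ρ k Q)).re - (G.newTerm act k s U₀ X (ρ k Q)).re + explZ k U X)
    (hclipb : ∀ k, clip k ≤ clipbar) (hNb : ∀ j, N j ≤ Nbar)
    (hqTb : (64 * clipa * cQa + lam * cQb) * ((1 + c) * Nbar) * (1 - ω)⁻¹ ≤ qTbar)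
    (hKP : TwoPointKP G W act 𝒜 n lip a d) (hdec : G.DecayExtract δv d) (hpin : G.PinBudget a δv (fun _ => B) κ)
    (hρ : ∀ (k : ℕ) (Q Q' : ι → ℝ) (M : ℝ),
      (∀ y, |Q y - Q' y| ≤ weightOf D.toC.frame D.κ₁ d0 O1 (D.Kp cdir + K.Kp cK w0 c0 c1) k y * M) →
        ‖ρ k Q - ρ k Q'‖ ≤ M)
    (hexplZ : ∀ (k : ℕ) (U : E) (X : (doubleCarriers C₀).Dom), (doubleCarriers C₀).scale X = k + 1 →
      |explZ k U X| ≤ Real.exp (-(κ * (doubleCarriers C₀).d X)) * p₀ k)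
    (hbase : ∀ g ∈ W, ∀ (U : E) (X : (doubleCarriers C₀).Dom), (doubleCarriers C₀).scale X = 0 →
      |Ef g U X| ≤ Real.exp (-(κ * (doubleCarriers C₀).d X)) * N 0)
    (hNsucc : ∀ j, p₀ j + 2 * B ≤ N (j + 1)) (hNnn : ∀ j, 0 ≤ N j)
    (hbox : ∀ (k : ℕ) (Q : ι → ℝ), (∀ y, |Q y| ≤ weightOf D.toC.frame D.κ₁ d0 O1 (D.Kp cdir + K.Kp cK w0 c0 c1) k y *
      sizeRadius (fun k j => (1 + c) * (tauOfG cQa (agePow ω) + tauOfG cQb (agePow ω)) k j) N k) → ρ k Q ∈ 𝒜 k)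
    (hB : 0 ≤ B) (hlipb : ∀ k, lip k ≤ lipbar) (hω : 0 ≤ ω) (hω1 : ω < 1)
    (hpos : 0 < ω + 8 * lipbar * B * ((1 + c) * (cQa + cQb))) :
    TermSize Ef W κ N ∧
      NE9 Ef W κ (prodModuli (8 * clipbar * B + 8 * lipbar * B * qTbar)
        fun _ => ω + 8 * lipbar * B * ((1 + c) * (cQa + cQb))) ∧
        FadingMemory ((8 * clipbar * B + 8 * lipbar * B * qTbar) / (ω + 8 * lipbar * B * ((1 + c) * (cQa + cQb))))
          (ω + 8 * lipbar * B * ((1 + c) * (cQa + cQb)))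
          (prodModuli (8 * clipbar * B + 8 * lipbar * B * qTbar)
            fun _ => ω + 8 * lipbar * B * ((1 + c) * (cQa + cQb))) := by
  have hℓg : ∀ k j, 0 ≤ ℓg k j := fun k j => (hℓ k j).le
  -- the kernel species' class is the curve species' class (same radii)
  have hMFb : MF ⊆ analyticClass K.R := by rw [hR]; exact hMF
  -- S-SUM of the sum (as in p215007)
  have hsum : ChannelStepSum MF (cpieceChannel D.toC + cpieceChannel K.toC) :=
    channelStepSum_add (channelStepSum_cpiece (pieceZero_cur D) (pieceLocal_cur D) (csrcScale_cur hD) MF)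
      (channelStepSum_cpiece (pieceZero_ker hK.kerZero) (pieceLocal_ker K) (csrcScale_ker hK) MF)
  -- S5 of each species on MF (as in p215007)
  have ha : ChannelSizeAtStepNN MF (cpieceChannel D.toC) κ (weightOf D.toC.frame D.κ₁ d0 O1 (D.Kp cdir))
      (tauOfG cQa (agePow ω)) :=
    channelSizeAtStepNN_mono hMF
      (channelSizeAtStepNN_cur hD hℓg κ hLa hO1 (fun k j => mul_nonneg hcQa (agePow_nonneg hω k j)))
  have hb : ChannelSizeAtStepNN MF (cpieceChannel K.toC) κ (weightOf K.toC.frame D.κ₁ d0 O1 (K.Kp cK w0 c0 c1))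
      (tauOfG cQb (agePow ω)) := by
    have h := channelSizeAtStepNN_mono hMFb
      (channelSizeAtStepNN_ker hK κ hLb hO1 (fun k j => mul_nonneg hcQb (agePow_nonneg hω k j)))
    rw [hκ₁] at h
    exact h
  -- S5 of the sum (crew (w25), common output frame)
  have hstep : ChannelSizeAtStepNN MF (cpieceChannel D.toC + cpieceChannel K.toC) κ
      (weightOf D.toC.frame D.κ₁ d0 O1 (D.Kp cdir + K.Kp cK w0 c0 c1))
      (tauOfG cQa (agePow ω) + tauOfG cQb (agePow ω)) :=
    channelSizeAtStepNN_add_cpiece D.toC K.toC hdY ha hb (kp_nonneg hD) (kp_nonneg_ker hK) hO1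
      (fun k j _ => mul_nonneg hcQa (agePow_nonneg hω k j)) (fun k j _ => mul_nonneg hcQb (agePow_nonneg hω k j))
  -- S3 of the sum from the displayed piece-additivity of each species
  have hadd : ChannelAdditive MF (cpieceChannel D.toC + cpieceChannel K.toC) :=
    channelAdditive_add (channelAdditive_cpiece (pieceAdditiveOn_mono hMF hAa))
      (channelAdditive_cpiece (pieceAdditiveOn_mono hMFb hAb))
  have hτ := profile_species hcQa hcQb hω
  -- the projected family is analytic: `P (Ef g) ∈ MF ⊆ analyticClass` (no new binder)
  have hPE : ∀ g ∈ W, P (Ef g) ∈ analyticClass D.R := fun g hg => hMF (hPinto (Ef g) (hAdm.1 g hg))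
  -- the scalar letters of the produced modulus
  have hNbar : 0 ≤ Nbar := (hNnn 0).trans (hNb 0)
  have h1ω : 0 < 1 - ω := by linarith
  have hq0 : 0 ≤ (64 * clipa * cQa + lam * cQb) * ((1 + c) * Nbar) * (1 - ω)⁻¹ := by positivity
  -- size FIRST, then A3 produced (A3-FED §2 fed with §2)
  exact termSize_ne9_and_fadingMemory_compProj_fed G ρ U₀ explZ h0 hAdm hres hPadd hPcomm hPinto hPsize hc hadd hsum hstep
    hfac hclip0 hCup (qT := fun _ => (64 * clipa * cQa + lam * cQb) * ((1 + c) * Nbar) * (1 - ω)⁻¹) (fun _ => hq0)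
    (tcup_species_proj hres hPcomm hPsize hc hAdm.1 hPE hNnn hNb hD hclipa hcdir hℓ hhalf hcont hlip hroom hLa hK hκ₁ hR
      hdY hlam hkerC hkerL hLb hO1 hcQa hcQb hω hω1)
    hreprV hclipb (fun _ => hqTb) hKP hdec hpin hρ hexplZ hbase hNsucc hNnn hbox hB hlipb (add_nonneg hcQa hcQb) hω hpos hτ

end Species

end Summit.QuantumFields.BalabanUV.T4Continuum.NE9SizeFedCouplingSpecies

end
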